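import Mathlib
import Summits.MatrixMultiplication.MatrixMultiplication.Theorems.SnSubsetDichotomyNoThresholdSubsetTripleLyapunovBand
import Summits.MatrixMultiplication.MatrixMultiplication.Theorems.SnSubsetDichotomyNoThresholdSubsetTripleDyadicPeel

/-!
# The (Q)-lemma: a self-bounding Lyapunov drift gives a speed-√n tail for the time-sum

Line `klr-graded-polynomial-method`, crux `SnSubsetDichotomy.NoThresholdSubsetTriple` (stmt-MatrixMultiplication-8302), lead c7
report `Cruxes/NoThresholdSubsetTriple/Lines/klr_graded_polynomial_method-lead-c7.md` §2a.  The quadratic-variation half (Q) of the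
Freedman architecture for J′ asks for `P(Σ_t q(ν_t) ≥ A n^{3/2}) ≤ e^{-c√n}`; this file proves the ABSTRACT statement: for a
nonnegative adapted process `q_t` with `q_0 = 0` satisfying the one-step inequalities
(L1) `μ[q_{t+1} − q_t | ℱ_t] ≤ K − c q_t/√n`, (L2) `|q_{t+1} − q_t| ≤ b√n`, (L3) `μ[(q_{t+1} − q_t)² | ℱ_t] ≤ C(q_t + 1)`,
one has `μ{A·n√n ≤ Σ_{t<n} q_t} ≤ 2·exp(−κ A √n)` with `κ = min(c/(8b), c²/(35C))`, for `A ≥ max(2K/c, 1)` and `κA√n ≥ log 2` —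
the composition of the two landed halves `stub_lyapunov_band` (Doob decomposition + Freedman's inequality `stub_freedman_exp`,
p150738/p151803) and `stub_dyadic_peel` (optimised exponent on dyadic bands + geometric sum, p151898).  What remains for (Q) itself is
DETERMINISTIC: the inequalities (L1*)/(L2)/(L3) for the Plancherel one-step transition from an arbitrary boxed shape (report §2a, app. A).
-/

open MeasureTheory ProbabilityTheory
open scoped BigOperators

namespace Summit.MatrixMultiplication.MatrixMultiplication.Theorems

set_option linter.dupNamespace false in
/-- **Self-bounding Lyapunov drift ⟹ speed-√n tail of the time-sum** (the (Q)-lemma of the lead c7 report, §2a): (L1) ∧ (L2) ∧ (L3)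
for a nonnegative adapted `q` with `q 0 = 0` give `μ{A·n·√n ≤ Σ_{t<n} q_t} ≤ 2·exp(−min(c/(8b), c²/(35C))·A·√n)` whenever
`A ≥ 2K/c`, `A ≥ 1` and `min(c/(8b), c²/(35C))·A·√n ≥ log 2`. [Freedman 1975, Thm. 1.6, via `stub_freedman_exp`] -/
theorem selfBounding_timeSum_tail {Ω : Type*} {mΩ : MeasurableSpace Ω} {μ : Measure Ω} [IsProbabilityMeasure μ]
    (ℱ : Filtration ℕ mΩ) (q : ℕ → Ω → ℝ) (n : ℕ) (hn : 1 ≤ n) (K c b C : ℝ) (hc : 0 < c) (hb : 0 < b) (hC : 0 < C)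
    (h_meas : ∀ t, StronglyMeasurable[ℱ t] (q t)) (h_nonneg : ∀ t ω, 0 ≤ q t ω) (h0 : ∀ ω, q 0 ω = 0)
    (hL1 : ∀ t, μ[fun ω => q (t + 1) ω - q t ω | ℱ t] ≤ᵐ[μ] fun ω => K - c * q t ω / Real.sqrt n)
    (hL2 : ∀ t ω, |q (t + 1) ω - q t ω| ≤ b * Real.sqrt n)
    (hL3 : ∀ t, μ[fun ω => (q (t + 1) ω - q t ω) ^ 2 | ℱ t] ≤ᵐ[μ] fun ω => C * (q t ω + 1))
    (A : ℝ) (hAK : 2 * K / c ≤ A) (hA1 : 1 ≤ A)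
    (hlog : Real.log 2 ≤ min (c / (8 * b)) (c ^ 2 / (35 * C)) * A * Real.sqrt n) :
    μ.real {ω | A * n * Real.sqrt n ≤ ∑ t ∈ Finset.range n, q t ω} ≤
      2 * Real.exp (-(min (c / (8 * b)) (c ^ 2 / (35 * C)) * A * Real.sqrt n)) :=
  stub_dyadic_peel μ (fun ω => ∑ t ∈ Finset.range n, q t ω) n hn K c b C hc hb hC
    (fun L lam _ hlam => stub_lyapunov_band ℱ q n (by omega) K c b C hc.le hb hC.le h_meas h_nonneg h0 hL1 hL2 hL3 L lam hlam)
    A hAK hA1 hlog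

end Summit.MatrixMultiplication.MatrixMultiplication.Theorems
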